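import Summits.AtomisticToContinuum.Crystallization.Theorems.ReggeStarCoercivityDefectFreeCrystallizesDevelopmentSteps1
import Summits.AtomisticToContinuum.Crystallization.Theorems.PalmUnimodularRigidityShellsToBarlowChartTransportSteps2

/-!
# The four in-layer transports `I, J, I⁻¹, J⁻¹` and the vertical transport `V` of frames read in integer charts (specifications, inverse identities, apexes) (part 2/7) (port to the abstract `1/20` chart clauses)

Port of `Theorems/PalmUnimodularRigidityShellsToBarlowChartTransportSteps2.lean` (crux 9227, line
`develop-the-model-growth-descent`) to the ABSTRACT chart clauses of line `palm-good-law` of crux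
stmt-AtomisticToContinuum-13603 (stub R1a4 `stub_combinatorialDevelopment`): the integer-chart hypothesis
`hch : ∀ z ∈ S, IsZChart S z …` is replaced by the section hypothesis `hch` = (pattern `fcc3Int`/`hcpInt`,
labelling `nb z` bijective onto the bonded neighbours, exact links) at every site ∧ the transfer identity for
every bonded pair; statements and proofs are otherwise verbatim (the transports `Istep, …, frameAt` and the
pattern facts `TransportPatterns*` are reused by name).  All `[folklore]` (HalesDSP2012 §1.3).
-/

noncomputable section

namespace Summit.AtomisticToContinuum.Crystallization.Theorems.PalmGoodLaw.Development

open Literature.Geometry.DiscreteGeometry Literature.MathematicalPhysics.StatisticalMechanics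
open Summit.AtomisticToContinuum.Crystallization.Theorems.ShellsToBarlowChartNegative
open Summit.AtomisticToContinuum.Crystallization.Theorems.PalmUnimodularRigidityShellsToBarlowChart

variable {S : Set (EuclideanSpace ℝ (Fin 3))} {Pc : (EuclideanSpace ℝ (Fin 3)) → Finset (Fin 3 → ℤ)}
  {nb : (EuclideanSpace ℝ (Fin 3)) → (Fin 3 → ℤ) → (EuclideanSpace ℝ (Fin 3))}
  (hch : (∀ z ∈ S, (Pc z = fcc3Int ∨ Pc z = hcpInt) ∧
      Set.BijOn (nb z) (↑(Pc z) : Set (Fin 3 → ℤ)) {y | y ∈ S ∧ (0 < dist z y ∧ dist z y ≤ 28 / 25)} ∧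
      (∀ t ∈ Pc z, ∀ t' ∈ Pc z,
        ((0 < dist (nb z t) (nb z t') ∧ dist (nb z t) (nb z t') ≤ 28 / 25) ↔ sqNormInt (t - t') = 18))) ∧
    (∀ x ∈ S, ∀ y ∈ S, (0 < dist x y ∧ dist x y ≤ 28 / 25) →
      ∀ (z z' : EuclideanSpace ℝ (Fin 3)) (t t' u u' : Fin 3 → ℤ),
        ((t = 0 ∧ z = x) ∨ (t ∈ Pc x ∧ z = nb x t)) → ((t' = 0 ∧ z' = x) ∨ (t' ∈ Pc x ∧ z' = nb x t')) →
        ((u = 0 ∧ z = y) ∨ (u ∈ Pc y ∧ z = nb y u)) → ((u' = 0 ∧ z' = y) ∨ (u' ∈ Pc y ∧ z' = nb y u')) →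
        sqNormInt (u - u') = sqNormInt (t - t')))

include hch in
/-- **The I-step.**  For a valid frame `⟨x, t₁, t₂, U⟩` in the admissible regime (the target
pattern is FCC, or the source pattern is HCP, or — for the upper layers of the development — the
labels at the target of `x` and `nb x t₂` are already known to be symmetric), `Istep` lands at
the bonded site `y = nb x t₁`,
produces a valid frame of the SAME parity, the type propagates (`x` HCP ⇒ `y` HCP), and the
labels at `y` of `x`, `nb x t₂`, `nb x (t₁ − t₂)` are `w`, `v`, `w − v` with `−w, −v` labels;
moreover the new upper cap is the cap of the label `μ` of the transported reference `nb x c₁`,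
`c₁` the unique `U`-element touching `t₁`, and `μ` is its unique element touching `w`.
[folklore] -/
theorem Istep_spec {x : (EuclideanSpace ℝ (Fin 3))} (hx : x ∈ S) {t₁ t₂ : Fin 3 → ℤ} {U : Finset (Fin 3 → ℤ)} (hU : IsFrame (Pc x) t₁ t₂ U) (hreg : Pc (nb x t₁) = fcc3Int ∨ Pc x = hcpInt ∨ (-zlab Pc nb (nb x t₁) x ∈ Pc (nb x t₁) ∧ -zlab Pc nb (nb x t₁) (nb x t₂) ∈ Pc (nb x t₁))) : nb x t₁ ∈ S ∧ (0 < dist x (nb x t₁) ∧ dist x (nb x t₁) ≤ 28 / 25) ∧ zlab Pc nb (nb x t₁) x ∈ Pc (nb x t₁) ∧ nb (nb x t₁) (zlab Pc nb (nb x t₁) x) = x ∧ zlab Pc nb (nb x t₁) (nb x t₂) ∈ Pc (nb x t₁) ∧ nb (nb x t₁) (zlab Pc nb (nb x t₁) (nb x t₂)) = nb x t₂ ∧ -zlab Pc nb (nb x t₁) x ∈ Pc (nb x t₁) ∧ -zlab Pc nb (nb x t₁) (nb x t₂) ∈ Pc (nb x t₁) ∧ sqNormInt (zlab Pc nb (nb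 x t₁) x - zlab Pc nb (nb x t₁) (nb x t₂)) = 18 ∧ zlab Pc nb (nb x t₁) (nb x (t₁ - t₂)) = zlab Pc nb (nb x t₁) x - zlab Pc nb (nb x t₁) (nb x t₂) ∧ (Pc x = hcpInt → Pc (nb x t₁) = hcpInt) ∧ IsFrame (Pc (nb x t₁)) (Istep Pc nb ⟨x, t₁, t₂, U⟩).t₁ (Istep Pc nb ⟨x, t₁, t₂, U⟩).t₂ (Istep Pc nb ⟨x, t₁, t₂, U⟩).U ∧ frameParity (Istep Pc nb ⟨x, t₁, t₂, U⟩).t₁ (Istep Pc nb ⟨x, t₁, t₂, U⟩).t₂ (Istep Pc nb ⟨x, t₁, t₂, U⟩).U = frameParity t₁ t₂ U ∧ ∃ c₁ ∈ U, sqNormInt (c₁ - t₁) = 18 ∧ U.filter (fun e => sqNormInt (e - t₁) = 18) = {c₁} ∧ (0 < dist (nb x t₁) (nb x c₁) ∧ dist (nb x t₁) (nb x c₁) ≤ 28 / 25) ∧ zlab Pc nb (nb x t₁) (nb x c₁) ∈ (Istep Pc nb ⟨x, t₁, t₂, U⟩).U ∧ (Istep Pc nb ⟨x, t₁, t₂,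 U⟩).U = capWithAny (Pc (nb x t₁)) (Istep Pc nb ⟨x, t₁, t₂, U⟩).t₁ (Istep Pc nb ⟨x, t₁, t₂, U⟩).t₂ {zlab Pc nb (nb x t₁) (nb x c₁)} ∧ (Istep Pc nb ⟨x, t₁, t₂, U⟩).U.filter (fun e => sqNormInt (e + (Istep Pc nb ⟨x, t₁, t₂, U⟩).t₁) = 18) = {zlab Pc nb (nb x t₁) (nb x c₁)} := by
  obtain ⟨h12, hhex, hUP, hoff, c, hcU, hform⟩ := hU
  have hPx := pattern_cases hch hx
  -- hexagon memberships at `x`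
  have ht₁ : t₁ ∈ Pc x := hhex (mem_hexLabels_iff.2 (Or.inl rfl))
  have ht₂ : t₂ ∈ Pc x := hhex (mem_hexLabels_iff.2 (Or.inr (Or.inl rfl)))
  have ht12 : t₁ - t₂ ∈ Pc x := hhex (mem_hexLabels_iff.2 (Or.inr (Or.inr (Or.inr (Or.inr (Or.inr rfl))))))
  have hcP : c ∈ Pc x := hUP hcU
  have hc : c ∉ hexLabels t₁ t₂ := hoff c hcU
  have hhx := dist_hexagon (Pc x) hPx t₁ ht₁ t₂ ht₂ h12 hhex
  -- the new site
  have hy := nb_mem hch hx ht₁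
  have hPy := pattern_cases hch hy.1
  -- bonds from `y` to `J = nb x t₂`, `K = nb x (t₁ - t₂)`
  have hbJ : 0 < dist (nb x t₁) (nb x t₂) ∧ dist (nb x t₁) (nb x t₂) ≤ 28 / 25 :=
    (bond_nb_iff hch hx ht₁ ht₂).2 h12
  have hbK : 0 < dist (nb x t₁) (nb x (t₁ - t₂)) ∧ dist (nb x t₁) (nb x (t₁ - t₂)) ≤ 28 / 25 :=
    (bond_nb_iff hch hx ht₁ ht12).2 hhx.2.2.2.2.2.1
  -- labels at `y`
  have hw := zlab_spec hch hy.1 hx (bond_symm hy.2)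
  have hv := zlab_spec hch hy.1 (nb_mem hch hx ht₂).1 hbJ
  have hκ := zlab_spec hch hy.1 (nb_mem hch hx ht12).1 hbK
  set w := zlab Pc nb (nb x t₁) x with hw_def
  set v := zlab Pc nb (nb x t₁) (nb x t₂) with hv_def
  set κ := zlab Pc nb (nb x t₁) (nb x (t₁ - t₂)) with hκ_def
  -- transfers among `x, J, K`
  have Dvw : sqNormInt (v - w) = 18 := by
    rw [hv_def, hw_def, transfer_nb_centre hch hx hy.1 hy.2 ht₂ hbJ, hhx.2.1]
  have Dwv : sqNormInt (w - v) = 18 := by rw [sqNormInt_sub_comm]; exact Dvw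
  have Dκw : sqNormInt (κ - w) = 18 := by
    rw [hκ_def, hw_def, transfer_nb_centre hch hx hy.1 hy.2 ht12 hbK, h12]
  have Dvκ : sqNormInt (v - κ) = 54 := by
    rw [hv_def, hκ_def, transfer_nb_nb hch hx hy.1 hy.2 ht₂ ht12 hbJ hbK]
    exact hhx.2.2.2.2.2.2.2.2.1
  have Dκv : sqNormInt (κ - v) = 54 := by rw [sqNormInt_sub_comm]; exact Dvκ
  -- the parity split on the source cap
  rcases hform with hE | hO
  · /- EVEN source cap `U = {c, c - t₁, c - t₂}`: reference `c₁ = c` -/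
    have hc1 : c - t₁ ∈ Pc x := hUP (by rw [hE]; simp)
    have hc2 : c - t₂ ∈ Pc x := hUP (by rw [hE]; simp)
    have hdx := dist_evenCap (Pc x) hPx t₁ ht₁ t₂ ht₂ c hcP h12 hhex hc hc1 hc2
    have hbu : 0 < dist (nb x t₁) (nb x c) ∧ dist (nb x t₁) (nb x c) ≤ 28 / 25 :=
      (bond_nb_iff hch hx ht₁ hcP).2 (by exact hdx.2.1)
    have hμ := zlab_spec hch hy.1 (nb_mem hch hx hcP).1 hbu
    set μ := zlab Pc nb (nb x t₁) (nb x c) with hμ_def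
    have Dμw : sqNormInt (μ - w) = 18 := by
      rw [hμ_def, hw_def, transfer_nb_centre hch hx hy.1 hy.2 hcP hbu]
      exact (wsqNormInt_eq hch hx) hcP
    have Dwμ : sqNormInt (w - μ) = 18 := by rw [sqNormInt_sub_comm]; exact Dμw
    have Dvμ : sqNormInt (v - μ) = 18 := by
      rw [hv_def, hμ_def, transfer_nb_nb hch hx hy.1 hy.2 ht₂ hcP hbJ hbu]; exact hdx.1
    -- regime: symmetric labels at `y` and type propagation
    have hsym : -w ∈ Pc (nb x t₁) ∧ -v ∈ Pc (nb x t₁) ∧ (Pc x = hcpInt → Pc (nb x t₁) = hcpInt) := by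
      by_cases hxh : Pc x = hcpInt
      · -- mirror pair through the lower cap
        have hfr : ∀ q, q ∈ hcpInt ↔ q ∈ Pc x := fun q => by rw [hxh]
        obtain ⟨d, hd, h48, hd1, hd2, hdoff, hL⟩ := lowerCap_evenCap_hcp t₁ ((hfr _).2 ht₁) t₂
          ((hfr _).2 ht₂) c ((hfr _).2 hcP) h12 (by rw [hxh] at hhex; exact hhex) hc
          ((hfr _).2 hc1) ((hfr _).2 hc2)
        have hdP : d ∈ Pc x := (hfr d).1 (mem_lowerCap_iff.1 hd).1
        have hdx' := dist_evenCap (Pc x) hPx t₁ ht₁ t₂ ht₂ d hdP h12 hhex hdoff ((hfr _).1 hd1)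
          ((hfr _).1 hd2)
        have hbl : 0 < dist (nb x t₁) (nb x d) ∧ dist (nb x t₁) (nb x d) ≤ 28 / 25 :=
          (bond_nb_iff hch hx ht₁ hdP).2 (by exact hdx'.2.1)
        obtain ⟨hPy', heq⟩ := hcp_of_mirror_pair hch hx ht₁ hcP hdP h48 hbu hbl
        have hlam := zlab_spec hch hy.1 (nb_mem hch hx hdP).1 hbl
        have Dwlam : sqNormInt (w - zlab Pc nb (nb x t₁) (nb x d)) = 18 := by
          rw [sqNormInt_sub_comm, hw_def, transfer_nb_centre hch hx hy.1 hy.2 hdP hbl]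
          exact (wsqNormInt_eq hch hx) hdP
        have Dvlam : sqNormInt (v - zlab Pc nb (nb x t₁) (nb x d)) = 18 := by
          rw [hv_def, transfer_nb_nb hch hx hy.1 hy.2 ht₂ hdP hbJ hbl]; exact hdx'.1
        exact ⟨heq w hw.1 Dwμ Dwlam, heq v hv.1 Dvμ Dvlam, fun _ => hPy'⟩
      · have hS : -w ∈ Pc (nb x t₁) ∧ -v ∈ Pc (nb x t₁) := by
          rcases hreg with hA | hB | hS
          · constructor
            · rw [hA] at hw ⊢; exact neg_mem_fcc3Int w hw.1
            · rw [hA] at hv ⊢; exact neg_mem_fcc3Int v hv.1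
          · exact (hxh hB).elim
          · exact hS
        exact ⟨hS.1, hS.2, fun h => (hxh h).elim⟩
    obtain ⟨hnw, hnv, htype⟩ := hsym
    -- hexagon at `y` and the identity `κ = w - v`
    have hhexwv : hexLabels w v ⊆ Pc (nb x t₁) :=
      hexLabels_subset_of_symm (Pc (nb x t₁)) hPy w hw.1 v hv.1 Dwv hnw hnv
    have hwv : w - v ∈ Pc (nb x t₁) :=
      hhexwv (mem_hexLabels_iff.2 (Or.inr (Or.inr (Or.inr (Or.inr (Or.inr rfl))))))
    have hκeq : κ = w - v :=
      label_third_vertex (Pc (nb x t₁)) hPy v hv.1 w hw.1 κ hκ.1 Dvw Dκw Dκv hwv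
    -- the apex fact at `y`
    obtain ⟨hframe, hpar, hcap, hapoff, hμw, hμv⟩ :=
      apex_I_even (Pc (nb x t₁)) hPy w hw.1 v hv.1 μ hμ.1 hnw hnv Dwv Dwμ Dvμ
    -- the source filter and the computation of `Istep`
    have hfilt : U.filter (fun e => sqNormInt (e - t₁) = 18) = {c} := by
      rw [hE]; exact (filter_evenCap (Pc x) hPx t₁ ht₁ t₂ ht₂ c hcP h12 hhex hc hc1 hc2).1
    have hI : Istep Pc nb ⟨x, t₁, t₂, U⟩ =
        ⟨nb x t₁, -w, v - w, ({μ - w, μ, μ - v} : Finset (Fin 3 → ℤ))⟩ := by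
      have h1 : Istep Pc nb ⟨x, t₁, t₂, U⟩ =
          ⟨nb x t₁, -w, v - w, capWithAny (Pc (nb x t₁)) (-w) (v - w) {μ}⟩ := by
        simp only [Istep, hfilt, Finset.image_singleton]
        try rfl
      rw [h1, hcap]
    have hparx : frameParity t₁ t₂ U = 1 := by
      rw [hE]; exact (isFrame_evenCap (Pc x) hPx t₁ ht₁ t₂ ht₂ c hcP h12 hhex hc hc1 hc2).2
    have hfilt' : ({μ - w, μ, μ - v} : Finset (Fin 3 → ℤ)).filter (fun e => sqNormInt (e + -w) = 18) = {μ} := by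
      have := (filter_evenCap (Pc (nb x t₁)) hPy (-w) hnw (v - w)
        (hhexwv (mem_hexLabels_iff.2 (Or.inr (Or.inr (Or.inl rfl))))) (μ - w) hμw
        (by rw [show -w - (v - w) = -v by abel, sqNormInt_neg]; exact (wsqNormInt_eq hch hy.1) hv.1)
        hframe.2.1 hapoff (by rw [show μ - w - -w = μ by abel]; exact hμ.1)
        (by rw [show μ - w - (v - w) = μ - v by abel]; exact hμv)).2.2.1
      rw [show μ - w - -w = μ by abel, show μ - w - (v - w) = μ - v by abel] at this
      exact this
    refine ⟨hy.1, hy.2, hw.1, hw.2, hv.1, hv.2, hnw, hnv, Dwv, hκeq, htype, ?_, ?_, c, hcU,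
      (by rw [sqNormInt_sub_comm]; exact hdx.2.1), hfilt, hbu, ?_, ?_, ?_⟩
    · rw [hI]; exact hframe
    · rw [hI, hparx]; exact hpar
    · rw [hI]; show μ ∈ _; simp
    · rw [hI]; exact hcap.symm
    · rw [hI]; exact hfilt'
  · /- ODD source cap `U = {c, c + t₁, c + t₂}`: reference `c₁ = c + t₁` -/
    have hc1 : c + t₁ ∈ Pc x := hUP (by rw [hO]; simp)
    have hc2 : c + t₂ ∈ Pc x := hUP (by rw [hO]; simp)
    have hdx := dist_oddCap (Pc x) hPx t₁ ht₁ t₂ ht₂ c hcP h12 hhex hc hc1 hc2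
    -- `c + t₁ ~ t₁` and `c + t₁ ~ t₁ - t₂`
    have h_c1t1 : sqNormInt (c + t₁ - t₁) = 18 := by
      rw [add_sub_cancel_right]; exact (wsqNormInt_eq hch hx) hcP
    have hbu : 0 < dist (nb x t₁) (nb x (c + t₁)) ∧ dist (nb x t₁) (nb x (c + t₁)) ≤ 28 / 25 :=
      (bond_nb_iff hch hx ht₁ hc1).2 (by rw [sqNormInt_sub_comm]; exact h_c1t1)
    have hμ := zlab_spec hch hy.1 (nb_mem hch hx hc1).1 hbu
    set μ := zlab Pc nb (nb x t₁) (nb x (c + t₁)) with hμ_def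
    have Dμw : sqNormInt (μ - w) = 18 := by
      rw [hμ_def, hw_def, transfer_nb_centre hch hx hy.1 hy.2 hc1 hbu]
      exact (wsqNormInt_eq hch hx) hc1
    have Dwμ : sqNormInt (w - μ) = 18 := by rw [sqNormInt_sub_comm]; exact Dμw
    have Dκμ : sqNormInt (κ - μ) = 18 := by
      rw [hκ_def, hμ_def, transfer_nb_nb hch hx hy.1 hy.2 ht12 hc1 hbK hbu]; exact hdx.2.2.2.2.2.2.1
    have Dvμ : sqNormInt (v - μ) = 36 := by
      rw [hv_def, hμ_def, transfer_nb_nb hch hx hy.1 hy.2 ht₂ hc1 hbJ hbu]; exact hdx.2.2.2.2.1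
    -- regime: symmetric labels at `y` and type propagation
    have hsym : -w ∈ Pc (nb x t₁) ∧ -v ∈ Pc (nb x t₁) ∧ (Pc x = hcpInt → Pc (nb x t₁) = hcpInt) := by
      by_cases hxh : Pc x = hcpInt
      · have hfr : ∀ q, q ∈ hcpInt ↔ q ∈ Pc x := fun q => by rw [hxh]
        obtain ⟨d, hd, h48, hd1, hd2, hdoff, hL⟩ := lowerCap_oddCap_hcp t₁ ((hfr _).2 ht₁) t₂
          ((hfr _).2 ht₂) c ((hfr _).2 hcP) h12 (by rw [hxh] at hhex; exact hhex) hc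
          ((hfr _).2 hc1) ((hfr _).2 hc2)
        have hdP : d ∈ Pc x := (hfr d).1 (mem_lowerCap_iff.1 hd).1
        have hd1P : d + t₁ ∈ Pc x := (hfr _).1 hd1
        have hdx' := dist_oddCap (Pc x) hPx t₁ ht₁ t₂ ht₂ d hdP h12 hhex hdoff hd1P ((hfr _).1 hd2)
        -- the lower reference `l = nb x (d + t₁)`, mirror partner of `u = nb x (c + t₁)`
        have h48' : sqNormInt (c + t₁ - (d + t₁)) = 48 := by
          rw [show c + t₁ - (d + t₁) = c - d by abel]; exact h48
        have hbl : 0 < dist (nb x t₁) (nb x (d + t₁)) ∧ dist (nb x t₁) (nb x (d + t₁)) ≤ 28 / 25 :=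
          (bond_nb_iff hch hx ht₁ hd1P).2 (by
            rw [sqNormInt_sub_comm, add_sub_cancel_right]; exact (wsqNormInt_eq hch hx) hdP)
        obtain ⟨hPy', heq⟩ := hcp_of_mirror_pair hch hx ht₁ hc1 hd1P h48' hbu hbl
        have hlam := zlab_spec hch hy.1 (nb_mem hch hx hd1P).1 hbl
        have Dwlam : sqNormInt (w - zlab Pc nb (nb x t₁) (nb x (d + t₁))) = 18 := by
          rw [sqNormInt_sub_comm, hw_def, transfer_nb_centre hch hx hy.1 hy.2 hd1P hbl]
          exact (wsqNormInt_eq hch hx) hd1P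
        have Dκlam : sqNormInt (κ - zlab Pc nb (nb x t₁) (nb x (d + t₁))) = 18 := by
          rw [hκ_def, transfer_nb_nb hch hx hy.1 hy.2 ht12 hd1P hbK hbl]; exact hdx'.2.2.2.2.2.2.1
        have hnw : -w ∈ Pc (nb x t₁) := heq w hw.1 Dwμ Dwlam
        have hnκ : -κ ∈ Pc (nb x t₁) := heq κ hκ.1 Dκμ Dκlam
        have hnv : -v ∈ Pc (nb x t₁) := by
          have hwP := hw.1; have hκP := hκ.1; have hvP := hv.1
          rw [hPy'] at hwP hκP hvP hnw hnκ ⊢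
          exact neg_mem_of_chain w hwP κ hκP v hvP hnw hnκ Dwv (by rw [sqNormInt_sub_comm]; exact Dκw) Dvκ
        exact ⟨hnw, hnv, fun _ => hPy'⟩
      · have hS : -w ∈ Pc (nb x t₁) ∧ -v ∈ Pc (nb x t₁) := by
          rcases hreg with hA | hB | hS
          · constructor
            · rw [hA] at hw ⊢; exact neg_mem_fcc3Int w hw.1
            · rw [hA] at hv ⊢; exact neg_mem_fcc3Int v hv.1
          · exact (hxh hB).elim
          · exact hS
        exact ⟨hS.1, hS.2, fun h => (hxh h).elim⟩
    obtain ⟨hnw, hnv, htype⟩ := hsym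
    have hhexwv : hexLabels w v ⊆ Pc (nb x t₁) :=
      hexLabels_subset_of_symm (Pc (nb x t₁)) hPy w hw.1 v hv.1 Dwv hnw hnv
    have hwv : w - v ∈ Pc (nb x t₁) :=
      hhexwv (mem_hexLabels_iff.2 (Or.inr (Or.inr (Or.inr (Or.inr (Or.inr rfl))))))
    have hκeq : κ = w - v :=
      label_third_vertex (Pc (nb x t₁)) hPy v hv.1 w hw.1 κ hκ.1 Dvw Dκw Dκv hwv
    have Dwvμ : sqNormInt (w - v - μ) = 18 := by rw [← hκeq]; exact Dκμ
    obtain ⟨hframe, hpar, hcap⟩ :=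
      apex_I_odd (Pc (nb x t₁)) hPy w hw.1 v hv.1 μ hμ.1 hnw hnv Dwv Dwμ Dwvμ Dvμ
    have hfilt : U.filter (fun e => sqNormInt (e - t₁) = 18) = {c + t₁} := by
      rw [hO]; exact (filter_oddCap (Pc x) hPx t₁ ht₁ t₂ ht₂ c hcP h12 hhex hc hc1 hc2).1
    have hI : Istep Pc nb ⟨x, t₁, t₂, U⟩ =
        ⟨nb x t₁, -w, v - w, ({μ, μ - w, μ + v - w} : Finset (Fin 3 → ℤ))⟩ := by
      have h1 : Istep Pc nb ⟨x, t₁, t₂, U⟩ =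
          ⟨nb x t₁, -w, v - w, capWithAny (Pc (nb x t₁)) (-w) (v - w) {μ}⟩ := by
        simp only [Istep, hfilt, Finset.image_singleton]
        try rfl
      rw [h1, hcap]
    have hparx : frameParity t₁ t₂ U = -1 := by
      rw [hO]; exact (isFrame_oddCap (Pc x) hPx t₁ ht₁ t₂ ht₂ c hcP h12 hhex hc hc1 hc2).2
    -- in the odd cap `{μ, μ + a, μ + b}` (`a = -w`, `b = v - w`) the element touching `-a = w` is `μ`
    have hfilt' : ({μ, μ - w, μ + v - w} : Finset (Fin 3 → ℤ)).filter (fun e => sqNormInt (e + -w) = 18) = {μ} := by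
      obtain ⟨-, -, -, hoff', _⟩ := id hframe
      have hμoff : μ ∉ hexLabels (-w) (v - w) := hoff' μ (by simp)
      have := (filter_oddCap (Pc (nb x t₁)) hPy (-w) hnw (v - w)
        (hhexwv (mem_hexLabels_iff.2 (Or.inr (Or.inr (Or.inl rfl))))) μ hμ.1
        (by rw [show -w - (v - w) = -v by abel, sqNormInt_neg]; exact (wsqNormInt_eq hch hy.1) hv.1)
        hframe.2.1 hμoff (by rw [show μ + -w = μ - w by abel]; exact hframe.2.2.1 (by simp))
        (by rw [show μ + (v - w) = μ + v - w by abel]; exact hframe.2.2.1 (by simp))).2.2.1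
      rw [show μ + -w = μ - w by abel, show μ + (v - w) = μ + v - w by abel] at this
      exact this
    refine ⟨hy.1, hy.2, hw.1, hw.2, hv.1, hv.2, hnw, hnv, Dwv, hκeq, htype, ?_, ?_, c + t₁,
      (by rw [hO]; simp), h_c1t1, hfilt, hbu, ?_, ?_, ?_⟩
    · rw [hI]; exact hframe
    · rw [hI, hparx]; exact hpar
    · rw [hI]; show μ ∈ _; simp
    · rw [hI]; exact hcap.symm
    · rw [hI]; exact hfilt'

/-- Landing anchor of this helper file (registered on crux stmt-AtomisticToContinuum-13603 for the port of stub R1a4;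
a label of the integer kissing pattern). [folklore] -/
theorem development_steps2_anchor : ![3, 3, 0] ∈ fcc3Int := by decide

end Summit.AtomisticToContinuum.Crystallization.Theorems.PalmGoodLaw.Development

end
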